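import Literature.MathematicalPhysics.QuantumLattice.XYZGroundStateOrderSpinHalfHolds
import Literature.MathematicalPhysics.QuantumLattice.XYZGroundStateOrderHolds
import Literature.MathematicalPhysics.QuantumLattice.AndersonXYTorusBound
import HarnessLib

/-!
# Ising-axis (Néel) ground-state order of the spin-½ XXZ antiferromagnet on `ℤ²` at strong anisotropy: a certified sub-window `Δ ≥ 5/2` of the printed Ising-like region

Topic `MathematicalPhysics/QuantumLattice`; sibling of `XYZGroundStateOrder.lean` (statements, B–U
vocabulary `anisotropicTorus`, `groundStateAxisCorrTorus`, `HasEvenTorusLRO`),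
`XYZGroundStateOrderWindow.lean` (the PLANAR window `0 ≤ Δ ≤ 0.15`, PROVED) and
`XXZIsingInfraredBound.lean` (the Ising-component infrared bound). This file treats the OTHER side of
the isotropic point: the Ising-like region of the spin-½ XXZ antiferromagnet
`Σ_{⟨jl⟩}(SˣSˣ + SʸSʸ + ΔSᶻSᶻ)` on the square lattice.

Printed results (all for `S = ½`, `d = 2`, ground state; none of the primaries is held, the
statements are quoted from the held secondary W–MH 1991, §1 p. 648 and Abstract/§5):

* Kubo–Kishi, PRL **61** (1988) 2585 [KuboKishi1988]: LRO "for S = 1/2 in the XY-like region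
  `0 ≤ Δ < 0.13` and the Ising-like region `Δ ≥ 1.78`" (as reported in W–MH §1);
* Ozeki–Nishimori–Tomita, J. Phys. Soc. Jpn. **58** (1989) 82: `Δ ≥ 1.72`; Nishimori–Ozeki, ibid.
  **58** (1989) 1027: `Δ ≥ 1.67` (W–MH §1: "the proof for the Ising-like region `Δ ≥ 1.67` given in
  [10] is rigorous");
* Wischmann–Müller-Hartmann, J. Phys. I France **1** (1991) 647 [WischmannMullerhartmann1991],
  Abstract: "We prove the existence of long-range order (LRO) in the ground state of the 2D quantum
  spin-1/2 XXZ-model for all anisotropies `0 ≤ Δ ≤ 0.22` and `Δ ≥ 1.47`" (Lanczos-computed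
  energy inputs, see the caveat in `XYZGroundStateOrder.lean`).

What is PROVED here (`xxz_ground_neel_spinHalf_isingSide`) is the certified sub-window
**`Δ ≥ 5/2`** — WEAKER than print (`-- TODO(general form)` below), obtained from inputs that are all
theorems of the tree: Björnberg–Ueltschi's Theorem 3.2 machinery at `β = ∞` [BjornbergUeltschi2022]
— FIRST lower bound, i.e. the sum rule, the `T = 0` infrared bound from ground-state Gaussian
domination (`buSpinHalf_gaussianDomination`, B–U Cor. 5.3) and the polarised-state bound (3.10)
(`xyz_polarised_bound`) —, the certified Riemann sums `R_L(2) ≤ 0.651`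
(`klsRiemannSum_two_eventually_le`), and ONE new input bounding B–U's `α(∞)` from ABOVE:
Anderson's star lower bound for the spin-½ XY torus [Anderson1951]
(`xyTorus_one_groundEnergy_ge`: `E₀ ≥ -(2d+1)L^d/8`), transported to the transverse nearest-neighbour
correlation of the XXZ ground state by a sublattice half-turn about the third axis
(`sublatticeOpZ_conj_anisotropicTorus`, Dyson–Lieb–Simon §2 / B–U Prop. 2.4) and a global frame
rotation. Kubo–Kishi's own route to `1.78` (their correlation inequalities) and W–MH's `1.47`
(improved kernels, Lanczos energies) are not reproduced.

## Dictionary (as in `XYZGroundStateOrder.lean`; explained, not asserted)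

On the even torus `(ℤ/2kℤ)²` the `π`-rotation about the `y`-axis on the odd sublattice carries the
antiferromagnet `Σ_{x∼y ordered}(SˣSˣ + SʸSʸ + ΔSᶻSᶻ)` (`Δ > 0`) to
`-Σ(SˣSˣ - SʸSʸ + ΔSᶻSᶻ) = Δ · anisotropicTorus 2 L 1 j (-j) 1` with `j = 1/Δ`, and STAGGERED (Néel)
order of the `z`-component to plain order of the third component, i.e. to `HasEvenTorusLRO` of
`groundStateAxisCorrTorus L 1 j (-j) 1` (direction 3). In B–U's normalisation
`J⁽³⁾ = 1 ≥ J⁽¹⁾ = j ≥ -J⁽²⁾ = j ≥ 0` this is the EXCLUDED endpoint `-J⁽²⁾/J⁽¹⁾ = 1` of the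
spin-½ planar criterion (3.9); order comes instead from the first bound of Theorem 3.2 because
`α(∞) = j·(c² - c¹) ≤ 5j/16` is small. The window proved: `0 ≤ j ≤ 2/5`, i.e. `Δ = 1/j ≥ 5/2`
(and the Ising ferromagnet `j = 0`).

## Proof architecture (tree's rotated frame `H' = anisotropicTorus d L n 1 J₂ J₁`, bond correlations `cᵅ = xyzBondCorr α`, `m = ĝ⁰₀/|Λ|`)

1. `sublatticeOpZ_conj_anisotropicTorus`: `U H(a,b,c) Uᴴ = H(-a,-b,c)` (half-turn about the third
   axis on the odd sublattice); `anisotropicTorus_one_one_zero`: `H(1,1,0) = 2·xyTorus`.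
2. `xyz_bondCorr_two_sub_one_le` (spin ½, any couplings, even torus of side `≥ 4`):
   `c² - c¹ ≤ (2d+1)/(8d)` — `E₀(H(0,-1,1)) ≤ Re ω(H(0,-1,1)) = -2dL^d(c² - c¹)` and
   `E₀(H(0,-1,1)) = E₀(H(0,1,1)) = E₀(H(1,1,0)) = 2E₀(xyTorus) ≥ -(2d+1)L^d/4`.
3. `isingSide_positivity`: `0 ≤ a ≤ 1/8`, `R ≤ 0.651`, `¼ ≤ c⁰ + a`, `c⁰ ≤ m + ½√a R ⇒ m ≥ 1/128`.
4. `xxz_ground_neel_spinHalf_isingSide_of_gaussianDomination` and the theorem: with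
   `J₁ = j`, `J₂ = -j`: `a = J₂c¹ + J₁c² = j(c² - c¹) ∈ [0, 5j/16]`, `|J₁c¹ + J₂c²| ≤ a`
   (`xyz_abs_b_le_a`), `xyz_ineq`, `xyz_polarised_bound`, eventually `R_{2k} ≤ 0.651`.

No definition and no named fact is introduced; sorry-free.

## References

* [KuboKishi1988] K. Kubo, T. Kishi, *Existence of long-range order in the XXZ model*, Phys. Rev.
  Lett. 61 (1988) 2585 — Ising-like region `Δ ≥ 1.78` (statement as reported in W–MH 1991 §1;
  primary not held, acq-01618 cite-only).
* [WischmannMullerhartmann1991] H.-A. Wischmann, E. Müller-Hartmann, J. Phys. I France 1 (1991)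
  647–657, doi:10.1051/jp1:1991109 — Abstract (p. 647), §1 (p. 648), §5 (p. 655): `Δ ≥ 1.47`.
* [BjornbergUeltschi2022] J. E. Björnberg, D. Ueltschi, in: The Physics and Mathematics of Elliott
  Lieb, vol. I (EMS Press, 2022) 77–108 = arXiv:2204.12896 — Thm. 3.2 (first bound), (3.10),
  Prop. 2.4, Lemma 4.4, Cor. 5.3, (4.38)–(4.41).
* [Anderson1951] P. W. Anderson, Phys. Rev. 83 (1951) 1260 — cluster (star) lower bound.
* [DysonLiebSimon1978] F. J. Dyson, E. H. Lieb, B. Simon, J. Stat. Phys. 18 (1978) 335, §2 —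
  sublattice rotations.
-/

noncomputable section

open Matrix Finset Filter Topology
open scoped ComplexOrder
open Literature.MathematicalPhysics.QuantumLattice Literature.MathematicalPhysics.QuantumLattice.SpinOperators
  Literature.Probability.LatticeModels

namespace Literature.MathematicalPhysics.QuantumLattice

variable {d : ℕ}

/-! ### 1. Two more frame changes: the sublattice half-turn about the third axis; `H(1,1,0) = 2·H_XY` -/

section Frames

variable (n : ℕ)

/-- The rotation by `π` about the `3`-axis: a unitary `T` with `T Sˣ Tᴴ = -Sˣ`, `T Sʸ Tᴴ = -Sʸ`,
`T Sᶻ Tᴴ = Sᶻ` (the square of the quarter turn `exists_unitary_conj_spinX_eq_neg_spinY`).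
[cite: BjornbergUeltschi2022, Prop. 2.4] -/
theorem exists_halfTurn_z :
    ∃ T : Matrix (Fin (n + 1)) (Fin (n + 1)) ℂ, T * Tᴴ = 1 ∧ Tᴴ * T = 1 ∧
      T * spinX n * Tᴴ = -spinX n ∧ T * spinY n * Tᴴ = -spinY n ∧
      T * SpinOperators.spinZ n * Tᴴ = SpinOperators.spinZ n := by
  obtain ⟨D, hD, hD', hDx, hDy, hDz⟩ := exists_unitary_conj_spinX_eq_neg_spinY n
  have conj2 : ∀ A : Matrix (Fin (n + 1)) (Fin (n + 1)) ℂ,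
      D * D * A * (D * D)ᴴ = D * (D * A * Dᴴ) * Dᴴ := by
    intro A
    rw [conjTranspose_mul]
    simp only [Matrix.mul_assoc]
  refine ⟨D * D, ?_, ?_, ?_, ?_, ?_⟩
  · rw [conjTranspose_mul, Matrix.mul_assoc, ← Matrix.mul_assoc D Dᴴ, hD, Matrix.one_mul, hD]
  · rw [conjTranspose_mul, Matrix.mul_assoc, ← Matrix.mul_assoc Dᴴ D, hD', Matrix.one_mul, hD']
  · rw [conj2, hDx, Matrix.mul_neg, Matrix.neg_mul, hDy]
  · rw [conj2, hDy, hDx]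
  · rw [conj2, hDz, hDz]

variable {n}

/-- **Sublattice half-turn about the third axis flips the first two couplings** (Dyson–Lieb–Simon
1978 §2; B–U Prop. 2.4, a `W_x` on the odd sites): on the even torus, for a single-site unitary `t`
with `t Sˣ tᴴ = -Sˣ`, `t Sʸ tᴴ = -Sʸ`, `t Sᶻ tᴴ = Sᶻ` placed on the odd sublattice,
`U H(a,b,c) Uᴴ = H(-a,-b,c)`. Companion of `sublatticeOp_conj_anisotropicTorus` (half-turn about the
first axis, `H(a,b,c) ↦ H(a,-b,-c)`). [cite: BjornbergUeltschi2022, Prop. 2.4]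
[cite: DysonLiebSimon1978, §2] -/
theorem sublatticeOpZ_conj_anisotropicTorus (k : ℕ) [NeZero (2 * k)]
    {t : Matrix (Fin (n + 1)) (Fin (n + 1)) ℂ} (hta : t * tᴴ = 1) (htb : tᴴ * t = 1)
    (htx : t * spinX n * tᴴ = -spinX n) (hty : t * spinY n * tᴴ = -spinY n)
    (htz : t * SpinOperators.spinZ n * tᴴ = SpinOperators.spinZ n) (a b c : ℝ) :
    productOp (fun z : TorusSite d (2 * k) =>
        if (∑ j, ZMod.castHom (dvd_mul_right 2 k) (ZMod 2) (z j)) = 0 then (1 : Matrix _ _ ℂ) else t) *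
        anisotropicTorus d (2 * k) n a b c *
        (productOp (fun z : TorusSite d (2 * k) =>
          if (∑ j, ZMod.castHom (dvd_mul_right 2 k) (ZMod 2) (z j)) = 0 then (1 : Matrix _ _ ℂ) else t))ᴴ =
      anisotropicTorus d (2 * k) n (-a) (-b) c := by
  set u : TorusSite d (2 * k) → Matrix (Fin (n + 1)) (Fin (n + 1)) ℂ := fun z =>
    if (∑ j, ZMod.castHom (dvd_mul_right 2 k) (ZMod 2) (z j)) = 0 then 1 else t with hu
  set sgn : TorusSite d (2 * k) → ℂ := fun z =>
    if (∑ j, ZMod.castHom (dvd_mul_right 2 k) (ZMod 2) (z j)) = 0 then 1 else -1 with hsgn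
  have hua : ∀ z, u z * (u z)ᴴ = 1 := by
    intro z; simp only [hu]; split_ifs
    · rw [conjTranspose_one, Matrix.mul_one]
    · exact hta
  have hub : ∀ z, (u z)ᴴ * u z = 1 := by
    intro z; simp only [hu]; split_ifs
    · rw [conjTranspose_one, Matrix.mul_one]
    · exact htb
  have hux : ∀ z, u z * spinVec n 0 * (u z)ᴴ = sgn z • spinVec n 0 := by
    intro z; simp only [hu, hsgn, spinVec_zero]; split_ifs
    · rw [conjTranspose_one, Matrix.mul_one, Matrix.one_mul, one_smul]
    · rw [htx, neg_one_smul]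
  have huy : ∀ z, u z * spinVec n 1 * (u z)ᴴ = sgn z • spinVec n 1 := by
    intro z; simp only [hu, hsgn, spinVec_one]; split_ifs
    · rw [conjTranspose_one, Matrix.mul_one, Matrix.one_mul, one_smul]
    · rw [hty, neg_one_smul]
  have huz : ∀ z, u z * spinVec n 2 * (u z)ᴴ = spinVec n 2 := by
    intro z; simp only [hu, spinVec_two]; split_ifs
    · rw [conjTranspose_one, Matrix.mul_one, Matrix.one_mul]
    · exact htz
  rw [productOp_conj_anisotropicTorus (2 * k) n hua hub, anisotropicTorus_eq]
  rw [neg_inj]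
  refine sum_congr rfl fun x _ => sum_congr rfl fun y _ => ?_
  split_ifs with h
  · have hs : sgn x * sgn y = -1 := torusParity_sign_adj k h
    rw [hux, hux, huy, huy, huz, huz, onSite_smul', onSite_smul', onSite_smul', onSite_smul',
      smul_mul_smul_comm, smul_mul_smul_comm, hs]
    simp only [neg_smul, one_smul, smul_neg, Complex.ofReal_neg]
    rfl
  · rfl

variable (L : ℕ) [NeZero L] (n)

/-- **`H(1,1,0)` is twice the ferromagnetic XY Hamiltonian**:
`anisotropicTorus d L n 1 1 0 = -Σ_x Σ_{y∼x}(S⁰S⁰ + S¹S¹) = 2 · xyTorus d L n` (ordered pairs versus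
bonds, `anisotropicTorus_eq_two_smul_three`). [cite: KLS1988PRL, eq. (1)]
[cite: BjornbergUeltschi2022, eq. (2.4)] -/
theorem anisotropicTorus_one_one_zero :
    anisotropicTorus d L n 1 1 0 = (2 : ℂ) • xyTorus d L n := by
  rw [anisotropicTorus_eq_two_smul_three]
  congr 1
  rw [xyzBondHamiltonian₃, xyTorus, xxzHamiltonian, Complex.ofReal_neg, Complex.ofReal_one, neg_one_smul]
  congr 1
  refine sum_congr rfl fun e _ => ?_
  induction e using Sym2.ind with
  | h x y =>
    simp only [Sym2.lift_mk, xyzBond₃, Complex.ofReal_one, Complex.ofReal_zero, one_smul, zero_smul]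

end Frames

/-! ### 2. The transverse nearest-neighbour correlation is bounded by Anderson's XY constant -/

section Transverse

variable (J₁ J₂ : ℝ)

/-- **Anderson's bound transported to the rotated frame** (spin ½, even torus of side `2k ≥ 4`,
`d ≥ 1`, ANY couplings `J₁, J₂`): the ground-state bond correlations of `H' = H(1, J₂, J₁)` satisfy
`c² - c¹ ≤ (2d+1)/(8d)` (`5/16` in `d = 2`). Indeed `-2dL^d(c² - c¹) = Re ω(H(0,-1,1)) ≥ E₀(H(0,-1,1))`
(variational principle in the ground state), and `H(0,-1,1)` is unitarily equivalent — sublattice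
half-turn about the third axis, then the global frame rotation `S⁰ ↔ S²` — to
`H(1,1,0) = 2·H_XY`, whose ground energy is `≥ -(2d+1)L^d/4` by Anderson's star bound
(`xyTorus_one_groundEnergy_ge`). This is the upper bound on Björnberg–Ueltschi's `α(∞)` used on the
Ising-like side. [cite: Anderson1951] [cite: BjornbergUeltschi2022, Prop. 2.4 and (3.8)] -/
theorem xyz_bondCorr_two_sub_one_le (hd : 0 < d) (k : ℕ) (hk : 2 ≤ k) :
    haveI : NeZero (2 * k) := ⟨by omega⟩
    xyzBondCorr (d := d) 2 (2 * k) 1 J₁ J₂ - xyzBondCorr (d := d) 1 (2 * k) 1 J₁ J₂ ≤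
      (2 * d + 1) / (8 * d) := by
  haveI : NeZero (2 * k) := ⟨by omega⟩
  haveI : Nonempty (TensorIndex (TorusSite d (2 * k)) 2) := ⟨fun _ => 0⟩
  have hL3 : 3 ≤ 2 * k := by omega
  set L := 2 * k with hLdef
  have hLpos : (0 : ℝ) < (L : ℝ) ^ d := by positivity
  have hd' : (0 : ℝ) < d := by exact_mod_cast hd
  -- (1) variational principle in the ground state of `H'`
  have h1 := groundEnergy_le_groundStateFunctional_re
    (anisotropicTorus_isHermitian L 1 1 J₂ J₁ (d := d)) (anisotropicTorus_isHermitian L 1 0 (-1) 1 (d := d))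
  rw [re_groundStateFunctional_anisotropicTorus L 1 J₁ J₂ hL3 hd 0 (-1) 1] at h1
  -- (2) `E₀(H(0,-1,1)) = E₀(H(0,1,1))`: sublattice half-turn about the third axis
  obtain ⟨T, hT, hT', hTx, hTy, hTz⟩ := exists_halfTurn_z 1
  have h2 : (anisotropicTorus d L 1 0 (-1) 1).groundEnergy = (anisotropicTorus d L 1 0 1 1).groundEnergy := by
    have hconj := sublatticeOpZ_conj_anisotropicTorus (d := d) k hT hT' hTx hTy hTz 0 (-1) 1
    rw [neg_zero, neg_neg] at hconj
    rw [← hconj, Matrix.groundEnergy_unitary_conj]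
    refine Matrix.mem_unitaryGroup_iff.2 (productOp_mul_conjTranspose fun z => ?_)
    split_ifs
    · rw [conjTranspose_one, Matrix.mul_one]
    · exact hT
  -- (3) `E₀(H(0,1,1)) = E₀(H(1,1,0))`: global frame rotation `S⁰ ↔ S²`
  obtain ⟨V, hV, hV', hVz, hVx, hVy⟩ := exists_unitary_conj_spinZ_eq_spinX 1
  have h3 : (anisotropicTorus d L 1 0 1 1).groundEnergy = (anisotropicTorus d L 1 1 1 0).groundEnergy := by
    have hconj : productOp (fun _ : TorusSite d L => V) * anisotropicTorus d L 1 0 1 1 *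
        (productOp (fun _ : TorusSite d L => V))ᴴ = anisotropicTorus d L 1 1 1 0 := by
      rw [globalOp_conj_anisotropicTorus hV hV' (γ := ![2, 1, 0]) (ε := ![-1, 1, 1])
        (fun α => by fin_cases α <;> simp) (fun α => by
          fin_cases α
          · simpa using hVx
          · simpa using hVy
          · simpa using hVz) 0 1 1, anisotropicTorus_eq]
      rw [neg_inj]
      refine sum_congr rfl fun x _ => sum_congr rfl fun y _ => ?_
      split_ifs
      · simp only [Matrix.cons_val_zero, Matrix.cons_val_one, Matrix.cons_val, Complex.ofReal_zero,
          Complex.ofReal_one, zero_smul, one_smul, zero_add, add_zero]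
        abel
      · rfl
    have hWu : productOp (fun _ : TorusSite d L => V) ∈
        Matrix.unitaryGroup (TensorIndex (TorusSite d L) 2) ℂ :=
      Matrix.mem_unitaryGroup_iff.2 (productOp_mul_conjTranspose fun _ => hV)
    rw [← hconj, Matrix.groundEnergy_unitary_conj hWu]
  -- (4) `E₀(H(1,1,0)) = 2E₀(H_XY) ≥ -(2d+1)L^d/4`
  have h4 : (anisotropicTorus d L 1 1 1 0).groundEnergy = 2 * (xyTorus d L 1).groundEnergy := by
    rw [anisotropicTorus_one_one_zero, show (2 : ℂ) = ((2 : ℝ) : ℂ) by norm_num,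
      groundEnergy_smul_of_pos (xxzHamiltonian_isHermitian 1 (torusGraph d L) (-1) 0) two_pos]
  have h5 := xyTorus_one_groundEnergy_ge L hL3 (d := d)
  -- assemble: `-2dL^d (c² - c¹) ≥ -(2d+1)L^d/4`
  rw [h2, h3, h4] at h1
  set p := xyzBondCorr (d := d) 2 L 1 J₁ J₂ - xyzBondCorr (d := d) 1 L 1 J₁ J₂ with hp
  have h6 : 2 * (d : ℝ) * (L : ℝ) ^ d * p ≤ (2 * d + 1) / 4 * (L : ℝ) ^ d := by
    rw [hp]; nlinarith
  rw [le_div_iff₀ (by positivity)]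
  have h7 : p * (8 * (d : ℝ)) * (L : ℝ) ^ d ≤ (2 * d + 1) * (L : ℝ) ^ d := by nlinarith
  exact le_of_mul_le_mul_right h7 hLpos

end Transverse

/-! ### 3. Positivity of the first bound on the Ising-like side -/

/-- **Positivity of B–U's first bound for small `α`**: if `a ≤ 1/8`, `0 ≤ R ≤ 0.651`,
`¼ ≤ c⁰ + a` (the polarised-state bound (3.10)) and `c⁰ ≤ m + ½√a·R` ((4.39)–(4.41)), then
`m ≥ 1/128`: `√a ≤ 0.3536`, `m ≥ ¼ - a - ½·0.3536·0.651 ≥ 0.0099`.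
[cite: BjornbergUeltschi2022, Theorem 3.2 (first bound) and (3.10)] -/
theorem isingSide_positivity {c0 a R m : ℝ} (ha : a ≤ 1 / 8) (hR0 : 0 ≤ R)
    (hR : R ≤ 651 / 1000) (hV : 1 / 4 ≤ c0 + a) (hm : c0 ≤ m + 1 / 2 * Real.sqrt a * R) :
    1 / 128 ≤ m := by
  have hs0 : 0 ≤ Real.sqrt a := Real.sqrt_nonneg a
  have hs : Real.sqrt a ≤ 3536 / 10000 := by
    rw [show (3536 / 10000 : ℝ) = Real.sqrt ((3536 / 10000) ^ 2) from (Real.sqrt_sq (by norm_num)).symm]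
    exact Real.sqrt_le_sqrt (by nlinarith)
  have hsR : Real.sqrt a * R ≤ 3536 / 10000 * (651 / 1000) := mul_le_mul hs hR hR0 (by norm_num)
  nlinarith

/-! ### 4. Assembly and the theorem -/

/-- **The Ising-like window from Gaussian domination** (finite-volume assembly, `d = 2`, `S = ½`):
if ground-state Gaussian domination holds for `H' = anisotropicTorus 2 L 1 1 (-j) j` on all even tori
of side `L ≥ 4` (all real fields) and the punctured Riemann sums satisfy `R_L(2) ≤ 0.651`
eventually, then for `0 ≤ j ≤ 2/5` the ground states of `anisotropicTorus 2 L 1 j (-j) 1` have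
long-range order of the third component: eventually `(2k)⁻⁴ Σ_{x,y} ⟨S²_xS²_y⟩ = (2k)⁻² ĝ⁰₀ ≥ 1/128`.
Steps: `a = J₂c¹ + J₁c² = j(c² - c¹) ∈ [0, 5j/16] ⊆ [0, 1/8]` (`xyz_orbit_inequalities` (ii),
`xyz_bondCorr_two_sub_one_le`), `|J₁c¹ + J₂c²| ≤ a` (`xyz_abs_b_le_a`), the infrared bound (A)
(`xyz_infraredBound_of_groundEnergy_le`), `c⁰ ≤ m + ½√a R_L` (`xyz_ineq`), `¼ ≤ c⁰ + a`
(`xyz_polarised_bound`), `isingSide_positivity`. [cite: BjornbergUeltschi2022, Thm. 3.2 (first bound)]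
[cite: KuboKishi1988] -/
theorem xxz_ground_neel_spinHalf_isingSide_of_gaussianDomination
    (hGD : ∀ (L : ℕ) [NeZero L], Even L → 4 ≤ L → ∀ (j : ℝ), 0 ≤ j →
      ∀ h : TorusSite 2 L → ℝ,
        (anisotropicTorus 2 L 1 1 (-j) j).groundEnergy ≤
          (anisotropicTorus 2 L 1 1 (-j) j - (2 : ℂ) • xyGradField L 1 h +
            ((xyFieldEnergy L h : ℝ) : ℂ) • 1).groundEnergy)
    (hR : ∀ᶠ L : ℕ in atTop, klsRiemannSum 2 L ≤ 651 / 1000) (j : ℝ) (hj : 0 ≤ j)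
    (hj' : j ≤ 2 / 5) :
    HasEvenTorusLRO (fun L x y => groundStateAxisCorrTorus (d := 2) L 1 j (-j) 1 x y) := by
  rw [hasEvenTorusLRO_iff]
  have h2k : Tendsto (fun k : ℕ => 2 * k) atTop atTop :=
    tendsto_atTop_atTop.2 fun b => ⟨b, fun k hk => by omega⟩
  have hRk : ∀ᶠ k : ℕ in atTop, klsRiemannSum 2 (2 * k) ≤ 651 / 1000 := h2k.eventually hR
  have hev : ∀ᶠ k : ℕ in atTop, (1 / 128 : ℝ) ≤
      (∑ x ∈ halfOpenBox 2 (2 * k), ∑ y ∈ halfOpenBox 2 (2 * k),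
          torusPullback (fun L x y => groundStateAxisCorrTorus (d := 2) L 1 j (-j) 1 x y) (2 * k) x y) /
        ((halfOpenBox 2 (2 * k)).card : ℝ) ^ 2 := by
    filter_upwards [hRk, eventually_ge_atTop 2] with k hk hk2
    haveI : NeZero (2 * k) := ⟨by omega⟩
    rw [xyz_lroSeq_eq 1 k (by omega) j (-j)]
    -- `a = J₂c¹ + J₁c² = j (c² - c¹) ∈ [0, 1/8]`
    have hp := xyz_bondCorr_two_sub_one_le j (-j) (by norm_num : 0 < 2) k hk2
    have h516 : (2 * ((2 : ℕ) : ℝ) + 1) / (8 * ((2 : ℕ) : ℝ)) = 5 / 16 := by norm_num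
    rw [h516] at hp
    have ha : -j * xyzBondCorr (d := 2) 1 (2 * k) 1 j (-j) + j * xyzBondCorr (d := 2) 2 (2 * k) 1 j (-j) ≤
        1 / 8 := by
      nlinarith [mul_le_mul_of_nonneg_left hp hj]
    -- `|J₁c¹ + J₂c²| ≤ a`
    have hPF₁ := xyz_abs_bondCorr_one_le_two (2 * k) 1 j (-j) (by omega) (by linarith) (by linarith)
      (d := 2)
    have hab : |j * xyzBondCorr (d := 2) 1 (2 * k) 1 j (-j) + -j * xyzBondCorr (d := 2) 2 (2 * k) 1 j (-j)| ≤
        -j * xyzBondCorr (d := 2) 1 (2 * k) 1 j (-j) + j * xyzBondCorr (d := 2) 2 (2 * k) 1 j (-j) :=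
      xyz_abs_b_le_a (by linarith) (by linarith) hPF₁
    -- (A) and `c⁰ ≤ m + ½ √a R`
    have hA := fun q hq => xyz_infraredBound_of_groundEnergy_le (2 * k) 1 j (-j) (by omega) (by norm_num)
      (fun h => hGD (2 * k) (even_two_mul k) (by omega) j hj h) q hq
    have hineq := xyz_ineq 1 j (-j) (by norm_num : 1 ≤ 2) hk2 hab hA
    -- (V) `¼ ≤ c⁰ + a`
    have hV := xyz_polarised_bound (2 * k) 1 j (-j) (by omega) (by norm_num : 0 < 2) (d := 2)
    have hV' : 1 / 4 ≤ xyzBondCorr (d := 2) 0 (2 * k) 1 j (-j) +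
        (-j * xyzBondCorr (d := 2) 1 (2 * k) 1 j (-j) + j * xyzBondCorr (d := 2) 2 (2 * k) 1 j (-j)) := by
      norm_num at hV ⊢
      linarith
    exact isingSide_positivity ha (klsRiemannSum_nonneg _ _) hk hV' hineq
  exact lt_of_lt_of_le (by norm_num : (0 : ℝ) < 1 / 128)
    (le_liminf_of_le (isCoboundedUnder_ge_of_le atTop fun k => xyz_lroSeq_le 1 k j (-j)) hev)

/-- **Ising-axis (Néel) ground-state long-range order of the spin-½ XXZ antiferromagnet on `ℤ²` for
`Δ ≥ 5/2` — a certified sub-window of the printed Ising-like region** (Kubo–Kishi 1988: `Δ ≥ 1.78`;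
Ozeki–Nishimori–Tomita / Nishimori–Ozeki 1989: `1.72` / `1.67`; Wischmann–Müller-Hartmann 1991:
`Δ ≥ 1.47`, as printed in W–MH Abstract p. 647 and §1 p. 648). In Björnberg–Ueltschi's vocabulary:
for `d = 2`, `S = ½` and `0 ≤ j ≤ 2/5`, the ground states (tracial ground-state functional, `β → ∞`
before `L → ∞`) of `-Σ_x Σ_{y∼x}(j S⁽¹⁾S⁽¹⁾ - j S⁽²⁾S⁽²⁾ + S⁽³⁾S⁽³⁾)` on the even tori `(ℤ/2kℤ)²` —
`j = 1/Δ` times the sublattice-rotated spin-½ XXZ antiferromagnet `Σ(SˣSˣ + SʸSʸ + ΔSᶻSᶻ)`, the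
rotation carrying staggered `z`-order to plain order of the third component — have long-range
order in the third direction: `liminf_k (2k)⁻⁴ Σ_{x,y} ⟨S⁽³⁾_xS⁽³⁾_y⟩_GS > 0` (indeed `≥ 1/128`
eventually). `j = 0` is the Ising ferromagnet. Inputs: reflection positivity ⇒ ground-state Gaussian
domination (`buSpinHalf_gaussianDomination`), certified `R_L(2) ≤ 0.651`
(`klsRiemannSum_two_eventually_le`), Anderson's XY star bound (`xyz_bondCorr_two_sub_one_le`).
-- TODO(general form): the printed window `Δ ≥ 1.47` (W–MH 1991; `1.78` Kubo–Kishi 1988) needs the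
-- Kubo–Kishi correlation inequalities / W–MH's improved kernels and cluster energies; not vendored.
[cite: WischmannMullerhartmann1991, Abstract (p. 647) and §1 (p. 648)] [cite: KuboKishi1988]
[cite: BjornbergUeltschi2022, Theorem 3.2 (first bound)] -/
theorem xxz_ground_neel_spinHalf_isingSide :
    ∀ (j : ℝ), 0 ≤ j → j ≤ 2 / 5 →
      HasEvenTorusLRO (fun L x y => groundStateAxisCorrTorus (d := 2) L 1 j (-j) 1 x y) := by
  intro j hj hj'
  exact xxz_ground_neel_spinHalf_isingSide_of_gaussianDomination
    (fun L _ hL h4 j' hj'' h => buSpinHalf_gaussianDomination L 1 hL h4 hj'' (by linarith) h)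
    klsRiemannSum_two_eventually_le j hj hj'

/-- The same window in the anisotropy parameter: for every `Δ ≥ 5/2` the ground states of
`anisotropicTorus 2 L 1 (1/Δ) (-(1/Δ)) 1` (`= Δ⁻¹ ×` the sublattice-rotated XXZ antiferromagnet with
anisotropy `Δ`) have long-range order of the third component along even tori.
[cite: WischmannMullerhartmann1991, §1 (p. 648)] [cite: KuboKishi1988] -/
theorem xxz_ground_neel_spinHalf_isingSide' (Δ : ℝ) (hΔ : 5 / 2 ≤ Δ) :
    HasEvenTorusLRO (fun L x y => groundStateAxisCorrTorus (d := 2) L 1 (1 / Δ) (-(1 / Δ)) 1 x y) := by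
  have hΔ0 : 0 < Δ := by linarith
  refine xxz_ground_neel_spinHalf_isingSide (1 / Δ) (by positivity) ?_
  rw [div_le_div_iff₀ hΔ0 (by norm_num : (0 : ℝ) < 5)]
  linarith

end Literature.MathematicalPhysics.QuantumLattice

end
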